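import Mathlib
import Literature.MathematicalPhysics.QuantumLattice.YangMillsClassical
import Literature.MathematicalPhysics.QuantumLattice.GrassmannIntegralProofs
import Literature.Analysis.FluidPDE.NSStrongSpeedBound
import HarnessLib

/-!
# Stub `stub_katoSobolevCutoff` of line `zero-mode-floor-dilute-gas`
(crux `Summit.QuantumFields.QCD.Theses.NestedDissectionSea.EarlyCrosserLaw`,
item stmt-QuantumFields-13995)

The **cut-off Kato–Sobolev bound**, GIVEN the sharp `L⁴`-Sobolev inequality on `ℝ⁴` (S2a) and
the pointwise Dirac–Kato inequality with constant `4/5` (S2b), both taken verbatim as hypotheses: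
for a smooth connection `A` on `ℝ⁴ = EuclideanSpace ℝ (Fin 4)` with anti-Hermitian values in
`M₃(ℂ)` (`A_μ(x) := A x e_μ`, `e_μ = EuclideanSpace.single μ 1`), a smooth spinor field
`ψ : ℝ⁴ → ℂ⁴ ⊗ ℂ³` with `Σ_μ γ_μ ∇_μ ψ = 0` (`∇_μψ := ∂_μψ + A_μψ`), a smooth compactly supported
real cut-off `χ` and `θ > 0`,
`(∫ χ⁴ |ψ|⁴)^{1/2} ≤ (√6/(8π)) · [(1+θ)(4/5) ∫ χ² |∇ψ|² + (1+θ⁻¹) ∫ ‖dχ‖² |ψ|²]`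
(`|ψ|² = Σ ‖ψ_{sc}‖²`, `|∇ψ|² = Σ_μ Σ ‖(∇_μψ)_{sc}‖²`, `‖dχ(x)‖` the operator norm of `fderiv ℝ χ x`).

Proof.  For `η > 0` let `n := |ψ|²`, `F_η := χ (√(n + η²) − η)` (smooth, supported in `supp χ`).
`∂_v n = 2 Re⟨ψ, ∂_vψ⟩` and `Re⟨ψ, A_μψ⟩ = 0` (anti-Hermitian `A_μ`), so
`∂_μF_η = (√(n+η²) − η) ∂_μχ + χ Re⟨ψ, ∇_μψ⟩/√(n+η²)`; on `EuclideanSpace ℝ (Fin 4)` the operator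
norm of a functional is the `ℓ²` norm of its values on the standard basis; Young
`(a+b)² ≤ (1+θ⁻¹)a² + (1+θ)b²`, `(√(n+η²) − η)² ≤ n ≤ n + η²` and S2b at the point give
`‖dF_η‖² ≤ (1+θ)(4/5) χ² |∇ψ|² + (1+θ⁻¹) ‖dχ‖² |ψ|²`; S2a for `F_η` and monotonicity of the integral
(integrands continuous with compact support) bound `√(∫ F_η⁴)` uniformly in `η`; finally `η → 0⁺` by
dominated convergence (`F_η⁴ → χ⁴ n²`, dominated by `χ⁴ n²`).  Mathlib only, plus the tree notions
`Connection`, `IsSmoothConnection`, `euclideanGamma` (the last only through the hypotheses' shape)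
and the tree one-liner `Literature.Analysis.FluidPDE.sqrt_pow_four` (`(√x)⁴ = x²`).
-/


noncomputable section
open scoped BigOperators Matrix ContDiff Matrix.Norms.Frobenius ComplexConjugate
open MeasureTheory Filter Topology Literature.MathematicalPhysics.QuantumLattice
namespace Summit.QuantumFields.QCD.Cruxes.EarlyCrosserLaw.ZeroModeFloorDiluteGas

/-! ### Linear algebra on `ℝ⁴` and on the colour space -/

/-- On `EuclideanSpace ℝ (Fin 4)` the squared operator norm of a real functional `L` is the sum of
the squares of its values on the standard basis vectors `e_μ = EuclideanSpace.single μ 1`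
(Riesz representation `InnerProductSpace.toDual`). -/
theorem katoSobolev_opNorm_sq_eq_sum (L : EuclideanSpace ℝ (Fin 4) →L[ℝ] ℝ) :
    ‖L‖ ^ 2 = ∑ μ : Fin 4, (L (EuclideanSpace.single μ (1 : ℝ))) ^ 2 := by
  set v := (InnerProductSpace.toDual ℝ (EuclideanSpace ℝ (Fin 4))).symm L with hv
  have hL : L = InnerProductSpace.toDual ℝ (EuclideanSpace ℝ (Fin 4)) v := by simp [hv]
  have h1 : ‖L‖ = ‖v‖ := by rw [hL]; simp
  have h2 : ∀ μ : Fin 4, L (EuclideanSpace.single μ (1 : ℝ)) = v μ := by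
    intro μ
    rw [hL, InnerProductSpace.toDual_apply_apply, EuclideanSpace.inner_single_right]
    simp
  rw [h1, EuclideanSpace.real_norm_sq_eq]
  simp [h2]

/-- For an anti-Hermitian colour matrix `M` (`Mᴴ = -M`) and any spinor–colour vector `u`, the
pairing `Σ_{s,c} conj (u s c) (M u_s)_c` is purely imaginary: its real part vanishes. -/
theorem katoSobolev_re_antiherm (M : Matrix (Fin 3) (Fin 3) ℂ) (hM : Mᴴ = -M)
    (u : Fin 4 → Fin 3 → ℂ) :
    (∑ s, ∑ c, starRingEnd ℂ (u s c) * ∑ c' : Fin 3, M c c' * u s c').re = 0 := by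
  have hM' : ∀ i j, starRingEnd ℂ (M i j) = -M j i := by
    intro i j
    have h := congrFun (congrFun hM j) i
    simpa [Matrix.conjTranspose_apply] using h
  -- each `s`-summand is purely imaginary
  have key : ∀ s, (∑ c, starRingEnd ℂ (u s c) * ∑ c' : Fin 3, M c c' * u s c').re = 0 := by
    intro s
    set z : ℂ := ∑ c, starRingEnd ℂ (u s c) * ∑ c' : Fin 3, M c c' * u s c' with hz
    have hconj : starRingEnd ℂ z = -z := by
      have e1 : starRingEnd ℂ z = ∑ c, ∑ c', u s c * (-M c' c) * starRingEnd ℂ (u s c') := by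
        rw [hz, map_sum]
        refine Finset.sum_congr rfl fun c _ => ?_
        rw [map_mul, map_sum, Finset.mul_sum]
        refine Finset.sum_congr rfl fun c' _ => ?_
        rw [map_mul, hM', Complex.conj_conj]
        ring
      have e2 : z = ∑ c', ∑ c, starRingEnd ℂ (u s c') * (M c' c * u s c) := by
        rw [hz]
        refine Finset.sum_congr rfl fun c' _ => ?_
        rw [Finset.mul_sum]
      rw [e1, e2, Finset.sum_comm]
      rw [← Finset.sum_neg_distrib]
      refine Finset.sum_congr rfl fun c' _ => ?_
      rw [← Finset.sum_neg_distrib]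
      refine Finset.sum_congr rfl fun c _ => ?_
      ring
    have hre := congrArg Complex.re hconj
    simp only [Complex.conj_re, Complex.neg_re] at hre
    linarith
  rw [Complex.re_sum]
  exact Finset.sum_eq_zero fun s _ => key s

/-! ### Calculus of the regularised cut-off modulus -/

/-- Derivative of the modulus squared `n(y) = Σ_{s,c} ‖ψ y s c‖²` of a spinor field with
differentiable components (`ℂ` as a real inner product space, `HasFDerivAt.norm_sq`). -/
theorem katoSobolev_hasFDerivAt_normSq (ψ : EuclideanSpace ℝ (Fin 4) → Fin 4 → Fin 3 → ℂ)
    (x : EuclideanSpace ℝ (Fin 4)) (hψ : ∀ s c, DifferentiableAt ℝ (fun y => ψ y s c) x) :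
    HasFDerivAt (fun y => ∑ s, ∑ c, ‖ψ y s c‖ ^ 2)
      (∑ s, ∑ c, (2 : ℕ) • (innerSL ℝ (ψ x s c)).comp (fderiv ℝ (fun y => ψ y s c) x)) x := by
  refine HasFDerivAt.fun_sum fun s _ => ?_
  refine HasFDerivAt.fun_sum fun c _ => ?_
  exact (hψ s c).hasFDerivAt.norm_sq

/-- The derivative of `n = |ψ|²` evaluated on a vector `v` is `2 Re Σ_{s,c} conj (ψ) ∂_v ψ`. -/
theorem katoSobolev_normSq_deriv_apply (ψ : EuclideanSpace ℝ (Fin 4) → Fin 4 → Fin 3 → ℂ)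
    (x v : EuclideanSpace ℝ (Fin 4)) :
    (∑ s, ∑ c, (2 : ℕ) • (innerSL ℝ (ψ x s c)).comp (fderiv ℝ (fun y => ψ y s c) x)) v
      = 2 * (∑ s, ∑ c, starRingEnd ℂ (ψ x s c) * fderiv ℝ (fun y => ψ y s c) x v).re := by
  simp only [sum_apply, smul_apply, ContinuousLinearMap.comp_apply, innerSL_apply_apply,
    Complex.inner, nsmul_eq_mul, Nat.cast_ofNat, Complex.re_sum, Finset.mul_sum]
  refine Finset.sum_congr rfl fun s _ => Finset.sum_congr rfl fun c _ => ?_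
  rw [mul_comm (fderiv ℝ (fun y => ψ y s c) x v)]

/-! ### Pointwise real algebra -/

/-- The pointwise Kato–Young estimate, as pure real algebra: if `T_μ = f a_μ + c₀ R_μ / s`,
`Σ_μ R_μ² ≤ (4/5) n G` (Kato), `f² ≤ n ≤ s²`, `s > 0`, `θ > 0`, then
`Σ_μ T_μ² ≤ (1+θ)(4/5) c₀² G + (1+θ⁻¹) (Σ_μ a_μ²) n` (Young: `(p+q)² ≤ (1+θ⁻¹)p² + (1+θ)q²`). -/
theorem katoSobolev_pointwise (T a R : Fin 4 → ℝ) (f c₀ n G θ s : ℝ)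
    (hT : ∀ μ, T μ = f * a μ + c₀ * R μ / s) (hθ : 0 < θ)
    (hG : 0 ≤ G) (hf : f ^ 2 ≤ n) (hs : 0 < s) (hns : n ≤ s ^ 2)
    (hK : ∑ μ, R μ ^ 2 ≤ (4 / 5 : ℝ) * n * G) :
    ∑ μ, T μ ^ 2 ≤ (1 + θ) * (4 / 5 : ℝ) * (c₀ ^ 2 * G) + (1 + θ⁻¹) * ((∑ μ, a μ ^ 2) * n) := by
  have hyoung : ∀ μ, T μ ^ 2 ≤ (1 + θ⁻¹) * (f * a μ) ^ 2 + (1 + θ) * (c₀ * R μ / s) ^ 2 := by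
    intro μ
    have h1 : (1 + θ⁻¹) * (f * a μ) ^ 2 + (1 + θ) * (c₀ * R μ / s) ^ 2 - T μ ^ 2
        = θ⁻¹ * (f * a μ - θ * (c₀ * R μ / s)) ^ 2 := by
      rw [hT]
      field_simp
      ring
    have h2 : 0 ≤ θ⁻¹ * (f * a μ - θ * (c₀ * R μ / s)) ^ 2 := by positivity
    linarith
  have hSa : 0 ≤ ∑ μ, a μ ^ 2 := Finset.sum_nonneg fun μ _ => sq_nonneg _
  have hθ' : 0 < 1 + θ⁻¹ := by positivity
  have e : ∑ μ, ((1 + θ⁻¹) * (f * a μ) ^ 2 + (1 + θ) * (c₀ * R μ / s) ^ 2)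
      = (1 + θ⁻¹) * f ^ 2 * (∑ μ, a μ ^ 2) + (1 + θ) * (c₀ ^ 2 / s ^ 2) * ∑ μ, R μ ^ 2 := by
    rw [Finset.sum_add_distrib, Finset.mul_sum, Finset.mul_sum]
    congr 1 <;> refine Finset.sum_congr rfl fun μ _ => ?_ <;> ring
  have h3 : (1 + θ⁻¹) * f ^ 2 * (∑ μ, a μ ^ 2) ≤ (1 + θ⁻¹) * n * ∑ μ, a μ ^ 2 :=
    mul_le_mul_of_nonneg_right (mul_le_mul_of_nonneg_left hf hθ'.le) hSa
  have h4 : (1 + θ) * (c₀ ^ 2 / s ^ 2) * ∑ μ, R μ ^ 2 ≤ (1 + θ) * (4 / 5 : ℝ) * (c₀ ^ 2 * G) := by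
    have hns' : n / s ^ 2 ≤ 1 := by rwa [div_le_one (by positivity)]
    have step2 : (c₀ ^ 2 / s ^ 2) * ((4 / 5 : ℝ) * n * G) ≤ (4 / 5 : ℝ) * (c₀ ^ 2 * G) := by
      rw [show (c₀ ^ 2 / s ^ 2) * ((4 / 5 : ℝ) * n * G) = (4 / 5 : ℝ) * (c₀ ^ 2 * G) * (n / s ^ 2)
        by ring]
      exact mul_le_of_le_one_right (by positivity) hns'
    calc (1 + θ) * (c₀ ^ 2 / s ^ 2) * ∑ μ, R μ ^ 2
        ≤ (1 + θ) * ((c₀ ^ 2 / s ^ 2) * ((4 / 5 : ℝ) * n * G)) := by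
          rw [mul_assoc]
          exact mul_le_mul_of_nonneg_left (mul_le_mul_of_nonneg_left hK (by positivity))
            (by positivity)
      _ ≤ (1 + θ) * ((4 / 5 : ℝ) * (c₀ ^ 2 * G)) := mul_le_mul_of_nonneg_left step2 (by positivity)
      _ = (1 + θ) * (4 / 5 : ℝ) * (c₀ ^ 2 * G) := by ring
  calc ∑ μ, T μ ^ 2
      ≤ ∑ μ, ((1 + θ⁻¹) * (f * a μ) ^ 2 + (1 + θ) * (c₀ * R μ / s) ^ 2) :=
        Finset.sum_le_sum fun μ _ => hyoung μ
    _ = (1 + θ⁻¹) * f ^ 2 * (∑ μ, a μ ^ 2) + (1 + θ) * (c₀ ^ 2 / s ^ 2) * ∑ μ, R μ ^ 2 := e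
    _ ≤ (1 + θ⁻¹) * n * (∑ μ, a μ ^ 2) + (1 + θ) * (4 / 5 : ℝ) * (c₀ ^ 2 * G) := add_le_add h3 h4
    _ = (1 + θ) * (4 / 5 : ℝ) * (c₀ ^ 2 * G) + (1 + θ⁻¹) * ((∑ μ, a μ ^ 2) * n) := by ring

/-! ### The Sobolev step and the `η → 0⁺` limit -/

/-- The Sobolev step: from S2a (sharp `L⁴` Sobolev, hypothesis `hS`) and a pointwise bound
`‖dg‖² ≤ h` with `h` integrable, `√(∫ g⁴) ≤ (√6/(8π)) ∫ h` for smooth compactly supported `g`. -/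
theorem katoSobolev_sobolev_of_bound
    (hS : ∀ f : EuclideanSpace ℝ (Fin 4) → ℝ, ContDiff ℝ ∞ f → HasCompactSupport f →
      Real.sqrt (∫ x, f x ^ 4) ≤ (Real.sqrt 6 / (8 * Real.pi)) * ∫ x, ‖fderiv ℝ f x‖ ^ 2)
    {g h : EuclideanSpace ℝ (Fin 4) → ℝ} (hg : ContDiff ℝ ∞ g) (hgc : HasCompactSupport g)
    (hh : Integrable h) (hb : ∀ x, ‖fderiv ℝ g x‖ ^ 2 ≤ h x) :
    Real.sqrt (∫ x, g x ^ 4) ≤ (Real.sqrt 6 / (8 * Real.pi)) * ∫ x, h x := by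
  refine (hS g hg hgc).trans ?_
  refine mul_le_mul_of_nonneg_left ?_ (by positivity)
  exact integral_mono_of_nonneg (Eventually.of_forall fun x => sq_nonneg _) hh
    (Eventually.of_forall hb)

/-- Derivative of the regularised cut-off modulus `y ↦ χ y (√(n y + η²) − η)` at a point where
`n ≥ 0`, `η > 0` (product and chain rules, `HasFDerivAt.sqrt`). -/
theorem katoSobolev_hasFDerivAt_cutoff {n χ : EuclideanSpace ℝ (Fin 4) → ℝ}
    {n' χ' : EuclideanSpace ℝ (Fin 4) →L[ℝ] ℝ} {x : EuclideanSpace ℝ (Fin 4)} {η : ℝ}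
    (hη : 0 < η) (hn0 : 0 ≤ n x) (hn : HasFDerivAt n n' x) (hχ : HasFDerivAt χ χ' x) :
    HasFDerivAt (fun y => χ y * (Real.sqrt (n y + η ^ 2) - η))
      (χ x • ((1 / (2 * Real.sqrt (n x + η ^ 2))) • n') + (Real.sqrt (n x + η ^ 2) - η) • χ') x := by
  have hpos : n x + η ^ 2 ≠ 0 := ne_of_gt (by positivity)
  exact hχ.mul (((hn.add_const (η ^ 2)).sqrt hpos).sub_const η)

/-- The regularisation `√(t + η²) − η` of `√t` satisfies `0 ≤ √(t + η²) − η ≤ √t`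
for `t, η ≥ 0`. -/
theorem katoSobolev_reg_bounds {t η : ℝ} (ht : 0 ≤ t) (hη : 0 ≤ η) :
    0 ≤ Real.sqrt (t + η ^ 2) - η ∧ Real.sqrt (t + η ^ 2) - η ≤ Real.sqrt t := by
  constructor
  · rw [sub_nonneg]
    calc η = Real.sqrt (η ^ 2) := (Real.sqrt_sq hη).symm
      _ ≤ Real.sqrt (t + η ^ 2) := Real.sqrt_le_sqrt (by linarith)
  · rw [sub_le_iff_le_add, Real.sqrt_le_left (by positivity)]
    nlinarith [Real.sq_sqrt ht, Real.sqrt_nonneg t]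

/-- The limit `η → 0⁺`: if `√(∫ (χ (√(n + η²) − η))⁴) ≤ C` for every `η > 0`, with `χ, n`
continuous, `n ≥ 0` and `χ⁴ n²` integrable, then `√(∫ χ⁴ n²) ≤ C` (dominated convergence along
`𝓝[>] 0`, the integrands being dominated by `χ⁴ n²`, and continuity of `√`). -/
theorem katoSobolev_limit {χ n : EuclideanSpace ℝ (Fin 4) → ℝ} {C : ℝ} (hχ : Continuous χ)
    (hn : Continuous n) (hn0 : ∀ x, 0 ≤ n x)
    (hint : Integrable (fun x => χ x ^ 4 * (n x) ^ 2))
    (h : ∀ η : ℝ, 0 < η → Real.sqrt (∫ x, (χ x * (Real.sqrt (n x + η ^ 2) - η)) ^ 4) ≤ C) :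
    Real.sqrt (∫ x, χ x ^ 4 * (n x) ^ 2) ≤ C := by
  have hlim : Tendsto (fun η : ℝ => ∫ x, (χ x * (Real.sqrt (n x + η ^ 2) - η)) ^ 4) (𝓝[>] 0)
      (𝓝 (∫ x, χ x ^ 4 * (n x) ^ 2)) := by
    refine tendsto_integral_filter_of_dominated_convergence (fun x => χ x ^ 4 * (n x) ^ 2) ?_ ?_
      hint ?_
    · refine Eventually.of_forall fun η => ?_
      have hc : Continuous fun x => (χ x * (Real.sqrt (n x + η ^ 2) - η)) ^ 4 := by fun_prop
      exact hc.aestronglyMeasurable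
    · refine eventually_nhdsWithin_of_forall fun η hη => Eventually.of_forall fun x => ?_
      have hη' : (0 : ℝ) < η := hη
      obtain ⟨hf0, hf1⟩ := katoSobolev_reg_bounds (hn0 x) hη'.le
      rw [Real.norm_eq_abs, abs_of_nonneg (by positivity), mul_pow]
      refine mul_le_mul_of_nonneg_left ?_ (by positivity)
      calc (Real.sqrt (n x + η ^ 2) - η) ^ 4 ≤ (Real.sqrt (n x)) ^ 4 := pow_le_pow_left₀ hf0 hf1 4
        _ = n x ^ 2 := Literature.Analysis.FluidPDE.sqrt_pow_four (hn0 x)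
    · refine Eventually.of_forall fun x => ?_
      have hc : Continuous fun η : ℝ => (χ x * (Real.sqrt (n x + η ^ 2) - η)) ^ 4 := by fun_prop
      have h0 := hc.tendsto 0
      have e0 : (χ x * (Real.sqrt (n x + (0 : ℝ) ^ 2) - 0)) ^ 4 = χ x ^ 4 * n x ^ 2 := by
        rw [zero_pow two_ne_zero, add_zero, sub_zero, mul_pow,
          Literature.Analysis.FluidPDE.sqrt_pow_four (hn0 x)]
      rw [e0] at h0
      exact tendsto_nhdsWithin_of_tendsto_nhds h0
  have hsqrt := (Real.continuous_sqrt.tendsto _).comp hlim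
  refine le_of_tendsto hsqrt ?_
  exact eventually_nhdsWithin_of_forall fun η hη => h η hη

/-- The directional derivatives of the regularised cut-off modulus `F_η = χ (√(|ψ|² + η²) − η)`:
`∂_v F_η = (√(|ψ|² + η²) − η) ∂_v χ + χ Re⟨ψ, ∂_v ψ⟩ / √(|ψ|² + η²)`. -/
theorem katoSobolev_fderiv_cutoff_apply (ψ : EuclideanSpace ℝ (Fin 4) → Fin 4 → Fin 3 → ℂ)
    (χ : EuclideanSpace ℝ (Fin 4) → ℝ) (x v : EuclideanSpace ℝ (Fin 4)) {η : ℝ} (hη : 0 < η)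
    (hψ : ∀ s c, DifferentiableAt ℝ (fun y => ψ y s c) x) (hχ : DifferentiableAt ℝ χ x) :
    fderiv ℝ (fun y => χ y * (Real.sqrt ((∑ s, ∑ c, ‖ψ y s c‖ ^ 2) + η ^ 2) - η)) x v
      = (Real.sqrt ((∑ s, ∑ c, ‖ψ x s c‖ ^ 2) + η ^ 2) - η) * fderiv ℝ χ x v
        + χ x * (∑ s, ∑ c, starRingEnd ℂ (ψ x s c) * fderiv ℝ (fun y => ψ y s c) x v).re
          / Real.sqrt ((∑ s, ∑ c, ‖ψ x s c‖ ^ 2) + η ^ 2) := by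
  have hn0 : 0 ≤ ∑ s, ∑ c, ‖ψ x s c‖ ^ 2 := by positivity
  rw [(katoSobolev_hasFDerivAt_cutoff hη hn0 (katoSobolev_hasFDerivAt_normSq ψ x hψ)
    hχ.hasFDerivAt).fderiv]
  simp only [add_apply, smul_apply, smul_eq_mul]
  rw [katoSobolev_normSq_deriv_apply]
  have hs : Real.sqrt ((∑ s, ∑ c, ‖ψ x s c‖ ^ 2) + η ^ 2) ≠ 0 :=
    ne_of_gt (Real.sqrt_pos.2 (by positivity))
  field_simp
  ring

/-- `Re⟨u, d⟩ = Re⟨u, d + M u⟩` for an anti-Hermitian colour matrix `M`: the connection term drops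
out of `Re⟨ψ, ∇_μ ψ⟩`. -/
theorem katoSobolev_re_partial_eq_re_cov (M : Matrix (Fin 3) (Fin 3) ℂ) (hM : Mᴴ = -M)
    (u d : Fin 4 → Fin 3 → ℂ) :
    (∑ s, ∑ c, starRingEnd ℂ (u s c) * d s c).re
      = (∑ s, ∑ c, starRingEnd ℂ (u s c) * (d s c + ∑ c' : Fin 3, M c c' * u s c')).re := by
  simp only [mul_add, Finset.sum_add_distrib, Complex.add_re]
  rw [katoSobolev_re_antiherm M hM u, add_zero]

/-- The pointwise bound on the differential of `F_η = χ (√(|ψ|² + η²) − η)` at a point `x` where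
`A_μ(x)` is anti-Hermitian, the components of `ψ` and `χ` are differentiable and the Dirac equation
holds: by S2b (hypothesis `hK`, with `u = ψ(x)`, `v_μ = ∇_μψ(x)`) and Young's inequality,
`‖dF_η(x)‖² ≤ (1+θ)(4/5) χ(x)² |∇ψ(x)|² + (1+θ⁻¹) ‖dχ(x)‖² |ψ(x)|²`. -/
theorem katoSobolev_fderiv_bound
    (hK : ∀ (u : Fin 4 → Fin 3 → ℂ) (v : Fin 4 → Fin 4 → Fin 3 → ℂ),
      (∀ s c, ∑ μ : Fin 4, ∑ s' : Fin 4, euclideanGamma μ s s' * v μ s' c = 0) →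
      ∑ μ : Fin 4, (∑ s, ∑ c, starRingEnd ℂ (u s c) * v μ s c).re ^ 2
        ≤ (4 / 5 : ℝ) * (∑ s, ∑ c, ‖u s c‖ ^ 2) * ∑ μ : Fin 4, ∑ s, ∑ c, ‖v μ s c‖ ^ 2)
    (A : Connection (EuclideanSpace ℝ (Fin 4)) (Matrix (Fin 3) (Fin 3) ℂ))
    (ψ : EuclideanSpace ℝ (Fin 4) → Fin 4 → Fin 3 → ℂ) (χ : EuclideanSpace ℝ (Fin 4) → ℝ)
    {θ η : ℝ} (x : EuclideanSpace ℝ (Fin 4)) (hθ : 0 < θ) (hη : 0 < η)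
    (hAH : ∀ v, (A x v)ᴴ = -(A x v))
    (hψ : ∀ s c, DifferentiableAt ℝ (fun y => ψ y s c) x) (hχ : DifferentiableAt ℝ χ x)
    (hD : ∀ s c, ∑ μ : Fin 4, ∑ s' : Fin 4, euclideanGamma μ s s' *
      (fderiv ℝ (fun y => ψ y s' c) x (EuclideanSpace.single μ (1 : ℝ))
        + ∑ c' : Fin 3, A x (EuclideanSpace.single μ (1 : ℝ)) c c' * ψ x s' c') = 0) :
    ‖fderiv ℝ (fun y => χ y * (Real.sqrt ((∑ s, ∑ c, ‖ψ y s c‖ ^ 2) + η ^ 2) - η)) x‖ ^ 2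
      ≤ (1 + θ) * (4 / 5 : ℝ) * (χ x ^ 2 * ∑ μ : Fin 4, ∑ s, ∑ c,
          ‖fderiv ℝ (fun z => ψ z s c) x (EuclideanSpace.single μ (1 : ℝ))
            + ∑ c' : Fin 3, A x (EuclideanSpace.single μ (1 : ℝ)) c c' * ψ x s c'‖ ^ 2)
        + (1 + θ⁻¹) * (‖fderiv ℝ χ x‖ ^ 2 * ∑ s, ∑ c, ‖ψ x s c‖ ^ 2) := by
  rw [katoSobolev_opNorm_sq_eq_sum, katoSobolev_opNorm_sq_eq_sum (fderiv ℝ χ x)]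
  have hn0 : 0 ≤ ∑ s, ∑ c, ‖ψ x s c‖ ^ 2 := by positivity
  have hs : 0 < Real.sqrt ((∑ s, ∑ c, ‖ψ x s c‖ ^ 2) + η ^ 2) := Real.sqrt_pos.2 (by positivity)
  have hns : (∑ s, ∑ c, ‖ψ x s c‖ ^ 2) ≤ Real.sqrt ((∑ s, ∑ c, ‖ψ x s c‖ ^ 2) + η ^ 2) ^ 2 := by
    rw [Real.sq_sqrt (by positivity)]
    exact le_add_of_nonneg_right (sq_nonneg η)
  obtain ⟨hf0, hf1⟩ := katoSobolev_reg_bounds hn0 hη.le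
  have hf : (Real.sqrt ((∑ s, ∑ c, ‖ψ x s c‖ ^ 2) + η ^ 2) - η) ^ 2 ≤ ∑ s, ∑ c, ‖ψ x s c‖ ^ 2 := by
    calc (Real.sqrt ((∑ s, ∑ c, ‖ψ x s c‖ ^ 2) + η ^ 2) - η) ^ 2
        ≤ Real.sqrt (∑ s, ∑ c, ‖ψ x s c‖ ^ 2) ^ 2 := pow_le_pow_left₀ hf0 hf1 2
      _ = ∑ s, ∑ c, ‖ψ x s c‖ ^ 2 := Real.sq_sqrt hn0
  have hKx : ∑ μ : Fin 4, (∑ s, ∑ c, starRingEnd ℂ (ψ x s c) *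
      (fderiv ℝ (fun y => ψ y s c) x (EuclideanSpace.single μ (1 : ℝ))
        + ∑ c' : Fin 3, A x (EuclideanSpace.single μ (1 : ℝ)) c c' * ψ x s c')).re ^ 2
      ≤ (4 / 5 : ℝ) * (∑ s, ∑ c, ‖ψ x s c‖ ^ 2) * ∑ μ : Fin 4, ∑ s, ∑ c,
          ‖fderiv ℝ (fun z => ψ z s c) x (EuclideanSpace.single μ (1 : ℝ))
            + ∑ c' : Fin 3, A x (EuclideanSpace.single μ (1 : ℝ)) c c' * ψ x s c'‖ ^ 2 :=
    hK (ψ x) _ hD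
  have hT : ∀ μ : Fin 4,
      fderiv ℝ (fun y => χ y * (Real.sqrt ((∑ s, ∑ c, ‖ψ y s c‖ ^ 2) + η ^ 2) - η)) x
          (EuclideanSpace.single μ (1 : ℝ))
        = (Real.sqrt ((∑ s, ∑ c, ‖ψ x s c‖ ^ 2) + η ^ 2) - η)
            * fderiv ℝ χ x (EuclideanSpace.single μ (1 : ℝ))
          + χ x * (∑ s, ∑ c, starRingEnd ℂ (ψ x s c) *
              (fderiv ℝ (fun y => ψ y s c) x (EuclideanSpace.single μ (1 : ℝ))
                + ∑ c' : Fin 3, A x (EuclideanSpace.single μ (1 : ℝ)) c c' * ψ x s c')).re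
            / Real.sqrt ((∑ s, ∑ c, ‖ψ x s c‖ ^ 2) + η ^ 2) := by
    intro μ
    rw [katoSobolev_fderiv_cutoff_apply ψ χ x _ hη hψ hχ,
      katoSobolev_re_partial_eq_re_cov (A x (EuclideanSpace.single μ (1 : ℝ))) (hAH _) (ψ x)
        (fun s c => fderiv ℝ (fun y => ψ y s c) x (EuclideanSpace.single μ (1 : ℝ)))]
  exact katoSobolev_pointwise
    (fun μ => fderiv ℝ (fun y => χ y * (Real.sqrt ((∑ s, ∑ c, ‖ψ y s c‖ ^ 2) + η ^ 2) - η)) x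
      (EuclideanSpace.single μ (1 : ℝ)))
    (fun μ => fderiv ℝ χ x (EuclideanSpace.single μ (1 : ℝ)))
    (fun μ => (∑ s, ∑ c, starRingEnd ℂ (ψ x s c) *
      (fderiv ℝ (fun y => ψ y s c) x (EuclideanSpace.single μ (1 : ℝ))
        + ∑ c' : Fin 3, A x (EuclideanSpace.single μ (1 : ℝ)) c c' * ψ x s c')).re)
    (Real.sqrt ((∑ s, ∑ c, ‖ψ x s c‖ ^ 2) + η ^ 2) - η) (χ x) (∑ s, ∑ c, ‖ψ x s c‖ ^ 2)
    (∑ μ : Fin 4, ∑ s, ∑ c, ‖fderiv ℝ (fun z => ψ z s c) x (EuclideanSpace.single μ (1 : ℝ))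
      + ∑ c' : Fin 3, A x (EuclideanSpace.single μ (1 : ℝ)) c c' * ψ x s c'‖ ^ 2)
    θ (Real.sqrt ((∑ s, ∑ c, ‖ψ x s c‖ ^ 2) + η ^ 2)) hT hθ
    (Finset.sum_nonneg fun μ _ => Finset.sum_nonneg fun s _ => Finset.sum_nonneg fun c _ =>
      sq_nonneg _) hf hs hns hKx

/-- **S2f `stub_katoSobolevCutoff` — the cut-off Kato–Sobolev bound, GIVEN S2a and S2b.**
Hypotheses: S2a (sharp `L⁴` Sobolev on `ℝ⁴`, constant `√6/(8π)`) and S2b (Dirac–Kato `4/5`)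
verbatim.  Conclusion: for a smooth anti-Hermitian connection `A`, a smooth spinor field `ψ` with
`Σ_μ γ_μ ∇_μ ψ = 0`, a smooth compactly supported real cut-off `χ` and `θ > 0`:
`(∫ χ⁴|ψ|⁴)^{1/2} ≤ (√6/(8π))·[(1+θ)(4/5)∫χ²|∇ψ|² + (1+θ⁻¹)∫‖dχ‖²|ψ|²]`.
Proof: Sobolev (S2a) applied to the smooth compactly supported `F_η = χ(√(|ψ|² + η²) − η)`, whose
differential is bounded pointwise by Kato (S2b) and Young (`katoSobolev_fderiv_bound`), then
`η → 0⁺` by dominated convergence (`katoSobolev_limit`). -/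
theorem stub_katoSobolevCutoff :
    (∀ f : EuclideanSpace ℝ (Fin 4) → ℝ, ContDiff ℝ ((⊤ : ℕ∞) : WithTop ℕ∞) f → HasCompactSupport f → Real.sqrt (∫ x, f x ^ 4) ≤ (Real.sqrt 6 / (8 * Real.pi)) * ∫ x, ‖fderiv ℝ f x‖ ^ 2) →
    (∀ (u : Fin 4 → Fin 3 → ℂ) (v : Fin 4 → Fin 4 → Fin 3 → ℂ), (∀ s c, ∑ μ : Fin 4, ∑ s' : Fin 4, euclideanGamma μ s s' * v μ s' c = 0) → ∑ μ : Fin 4, (∑ s, ∑ c, starRingEnd ℂ (u s c) * v μ s c).re ^ 2 ≤ (4 / 5 : ℝ) * (∑ s, ∑ c, ‖u s c‖ ^ 2) * ∑ μ : Fin 4, ∑ s, ∑ c, ‖v μ s c‖ ^ 2) →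
    ∀ (A : Connection (EuclideanSpace ℝ (Fin 4)) (Matrix (Fin 3) (Fin 3) ℂ)) (ψ : EuclideanSpace ℝ (Fin 4) → Fin 4 → Fin 3 → ℂ) (χ : EuclideanSpace ℝ (Fin 4) → ℝ) (θ : ℝ), IsSmoothConnection A → (∀ x v, (A x v)ᴴ = -(A x v)) → ContDiff ℝ ((⊤ : ℕ∞) : WithTop ℕ∞) ψ → (∀ x s c, ∑ μ : Fin 4, ∑ s' : Fin 4, euclideanGamma μ s s' * (fderiv ℝ (fun y => ψ y s' c) x (EuclideanSpace.single μ (1 : ℝ)) + ∑ c' : Fin 3, A x (EuclideanSpace.single μ (1 : ℝ)) c c' * ψ x s' c') = 0) → ContDiff ℝ ((⊤ : ℕ∞) : WithTop ℕ∞) χ → HasCompactSupport χ → 0 < θ → Real.sqrt (∫ x, χ x ^ 4 * (∑ s, ∑ c, ‖ψ x s c‖ ^ 2) ^ 2) ≤ (Real.sqrt 6 / (8 * Real.pi)) * ((1 + θ) * (4 / 5 : ℝ) * (∫ x, χ x ^ 2 * (∑ μ : Fin 4, ∑ s, ∑ c, ‖fderiv ℝ (fun z => ψ z s c) x (EuclideanSpace.single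 μ (1 : ℝ)) + ∑ c' : Fin 3, A x (EuclideanSpace.single μ (1 : ℝ)) c c' * ψ x s c'‖ ^ 2)) + (1 + θ⁻¹) * (∫ x, ‖fderiv ℝ χ x‖ ^ 2 * (∑ s, ∑ c, ‖ψ x s c‖ ^ 2))) := by
  intro hS hK A ψ χ θ hA hAH hψ hD hχ hχc hθ
  have hne : (∞ : WithTop ℕ∞) ≠ 0 := by simp
  have hψc : ∀ s c, ContDiff ℝ ∞ (fun y => ψ y s c) := fun s c =>
    contDiff_pi.1 (contDiff_pi.1 hψ s) c
  have hn_smooth : ContDiff ℝ ∞ (fun y => ∑ s, ∑ c, ‖ψ y s c‖ ^ 2) :=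
    ContDiff.sum fun s _ => ContDiff.sum fun c _ => ContDiff.norm_sq ℝ (hψc s c)
  have hn0 : ∀ x, 0 ≤ ∑ s, ∑ c, ‖ψ x s c‖ ^ 2 := fun x =>
    Finset.sum_nonneg fun s _ => Finset.sum_nonneg fun c _ => sq_nonneg _
  have hχ_cont : Continuous χ := hχ.continuous
  have hdχ_cont : Continuous (fun x => fderiv ℝ χ x) := hχ.continuous_fderiv hne
  have hG_cont : Continuous (fun x => ∑ μ : Fin 4, ∑ s, ∑ c,
      ‖fderiv ℝ (fun z => ψ z s c) x (EuclideanSpace.single μ (1 : ℝ))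
        + ∑ c' : Fin 3, A x (EuclideanSpace.single μ (1 : ℝ)) c c' * ψ x s c'‖ ^ 2) := by
    have hA_cont : ∀ μ : Fin 4, Continuous fun x => A x (EuclideanSpace.single μ (1 : ℝ)) :=
      fun μ => hA.continuous.clm_apply continuous_const
    have h1 : ∀ (μ : Fin 4) (s : Fin 4) (c : Fin 3), Continuous fun x =>
        fderiv ℝ (fun z => ψ z s c) x (EuclideanSpace.single μ (1 : ℝ)) :=
      fun μ s c => ((hψc s c).continuous_fderiv hne).clm_apply continuous_const
    have h2 : ∀ (μ : Fin 4) (c c' : Fin 3), Continuous fun x =>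
        A x (EuclideanSpace.single μ (1 : ℝ)) c c' :=
      fun μ c c' => (hA_cont μ).matrix_elem c c'
    have h3 : ∀ (s : Fin 4) (c : Fin 3), Continuous fun x => ψ x s c :=
      fun s c => (hψc s c).continuous
    refine continuous_finsetSum _ fun μ _ => continuous_finsetSum _ fun s _ =>
      continuous_finsetSum _ fun c _ => ?_
    exact ((h1 μ s c).add
      (continuous_finsetSum _ fun c' _ => (h2 μ c c').mul (h3 s c'))).norm.pow 2
  have hout : ∀ x, x ∉ tsupport χ → χ x = 0 ∧ fderiv ℝ χ x = 0 := fun x hx =>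
    ⟨image_eq_zero_of_notMem_tsupport hx, fderiv_of_notMem_tsupport ℝ hx⟩
  have hint1 : Integrable (fun x => χ x ^ 2 * ∑ μ : Fin 4, ∑ s, ∑ c,
      ‖fderiv ℝ (fun z => ψ z s c) x (EuclideanSpace.single μ (1 : ℝ))
        + ∑ c' : Fin 3, A x (EuclideanSpace.single μ (1 : ℝ)) c c' * ψ x s c'‖ ^ 2) := by
    refine ((hχ_cont.pow 2).mul hG_cont).integrable_of_hasCompactSupport ?_
    refine HasCompactSupport.intro hχc fun x hx => ?_
    simp [(hout x hx).1]
  have hint2 : Integrable (fun x => ‖fderiv ℝ χ x‖ ^ 2 * ∑ s, ∑ c, ‖ψ x s c‖ ^ 2) := by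
    refine ((hdχ_cont.norm.pow 2).mul hn_smooth.continuous).integrable_of_hasCompactSupport ?_
    refine HasCompactSupport.intro hχc fun x hx => ?_
    simp [(hout x hx).2]
  have hint4 : Integrable (fun x => χ x ^ 4 * (∑ s, ∑ c, ‖ψ x s c‖ ^ 2) ^ 2) := by
    refine ((hχ_cont.pow 4).mul (hn_smooth.continuous.pow 2)).integrable_of_hasCompactSupport ?_
    refine HasCompactSupport.intro hχc fun x hx => ?_
    simp [(hout x hx).1]
  -- reduce to the regularised cut-off moduli `F_η = χ (√(|ψ|² + η²) - η)`
  refine katoSobolev_limit hχ_cont hn_smooth.continuous hn0 hint4 fun η hη => ?_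
  rw [← integral_const_mul, ← integral_const_mul,
    ← integral_add (hint1.const_mul _) (hint2.const_mul _)]
  refine katoSobolev_sobolev_of_bound hS ?_ ?_ ((hint1.const_mul _).add (hint2.const_mul _))
    fun x => ?_
  · exact hχ.mul (((hn_smooth.add contDiff_const).sqrt fun x => ne_of_gt (by positivity)).sub
      contDiff_const)
  · exact hχc.mul_right
  · exact katoSobolev_fderiv_bound hK A ψ χ x hθ hη (hAH x)
      (fun s c => (hψc s c).differentiable hne x) (hχ.differentiable hne x) (hD x)

end Summit.QuantumFields.QCD.Cruxes.EarlyCrosserLaw.ZeroModeFloorDiluteGas
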